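import Literature.AlgebraicGeometry.Motives.HodgeLieRigidTimesRankOne
import Literature.AlgebraicGeometry.Motives.HodgeLieIsomorphismInvariance
import HarnessLib

/-!
# `Θ`-rigidity is an invariant of the isomorphism class of a Hodge structure: `H` rigid ⟺ `e^* H` rigid for a linear equivalence `e : V ≃ W`
# (Moonen 1999 (1.7): `MT(e^* H) = e⁻¹ MT(H) e`; Deligne I §3.1)

Family `hodge`, layer `Literature/AlgebraicGeometry/Motives`; THEOREMS ONLY (no definition, no named fact).  Written for the cell `pub-hodgecm2`
(COR-CM), seat `b27` gen 51 (count-neutral Mumford–Tate-rank ladder).  The ladder's monotonicity `dim 𝔥(H ⊕ H') ≥ dim 𝔥(H)` for a `Θ`-RIGID `H`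
(`Motives/HodgeLieProductSimpleFactor`, `CorCM/MumfordTateRankRigidMonotone`) is used for `H = H¹(X₁)` with `X₁` given up to ISOGENY; an isogeny
`X₁ ⟶ X₁'` identifies `H¹(X₁') = e^* H¹(X₁)` (`Pohlmann1968/…HazamaCriterion`, `hodge_one_eq_comapEquiv_of_isIsogeny`), so rigidity must be
transported along `e^*`.  This file does the transport for an abstract Hodge structure.

`Θ`-RIGIDITY of `H`: every bracket-closed rational `𝔞 ⊆ 𝔥(H)` whose complex span contains a Hodge operator of `H` (an operator acting by `2p − n`
on `V^{p, n−p}`) contains `𝔥(H)`.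

* **`rigid_comapEquiv_of_rigid`** — `H` rigid ⟹ `e^* H = H.comapEquiv e` rigid;  **`rigid_iff_rigid_comapEquiv`** — both ways.
PROOF.  `e` and `e⁻¹` underlie mutually inverse morphisms `e^* H ⇄ H` (`Hom.ofComapBaseChange`, `Hom.symmOfComapBaseChange`), so the restriction
`X ↦ e X e⁻¹` maps every bracket-closed `𝔞 ⊆ 𝔥(e^* H)` with a Hodge operator in `𝔞 ⊗ ℂ` ONTO `𝔥(H)` when `H` is rigid
(`map_restrict_eq_hodgeLie_of_rigid`, Moonen–Zarhin (3.1)); and `𝔥(e^* H) = e⁻¹ 𝔥(H) e` (`conj_mem_hodgeLie_of_mem_hodgeLie_comapEquiv`), whence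
`𝔥(e^* H) ⊆ 𝔞` (conjugation is injective).
AV reading: `CorCM/MumfordTateRankRigidIsogenyInvariance` (`X ∼ X'`, `H¹X` rigid ⟹ `H¹X'` rigid).

## References
* [Moonen1999MTNotes] B. Moonen, *Notes on Mumford–Tate groups* (1999), (1.7), (1.8). [cite: Moonen1999MTNotes, (1.7) and (1.8)]
* [MoonenZarhin1999LowDim] B. Moonen, Yu. G. Zarhin, Math. Ann. 315 (1999), §3 (3.1) [corpus: paper:arxiv-math_9901113 p. 6]. [cite: MoonenZarhin1999LowDim, §3 (3.1)]
* [Deligne1982HodgeCycles] P. Deligne, LNM 900 (1982), I §3.1 and Prop. 3.4. [cite: Deligne1982HodgeCycles, I §3.1 and Prop. 3.4]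
-/

noncomputable section

open scoped TensorProduct

namespace Literature.AlgebraicGeometry.Motives

namespace HodgeStructure

universe u

variable {V : Type u} [AddCommGroup V] [Module ℚ V] [Module.Finite ℚ V]
  {W : Type u} [AddCommGroup W] [Module ℚ W] [Module.Finite ℚ W] [HodgeTensorFacts.{u, u}] {n : ℤ}

/-- **`H` `Θ`-rigid ⟹ `e^* H` `Θ`-rigid** (`e : V ≃ W`; `𝔥(e^* H) = e⁻¹ 𝔥(H) e`, and conjugation by `e` maps a bracket-closed `𝔞 ⊆ 𝔥(e^* H)` carrying a
Hodge operator onto `𝔥(H)`). [cite: Moonen1999MTNotes, (1.7) and (1.8)] [cite: MoonenZarhin1999LowDim, §3 (3.1)] -/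
theorem rigid_comapEquiv_of_rigid (H : HodgeStructure W n) (e : V ≃ₗ[ℚ] W)
    (hrig : ∀ 𝔞 : Submodule ℚ (Module.End ℚ W), 𝔞 ≤ H.hodgeLie →
      (∀ X ∈ 𝔞, ∀ Y ∈ 𝔞, X * Y - Y * X ∈ 𝔞) →
      (∃ Θ ∈ Submodule.span ℂ ((fun X : Module.End ℚ W => X.baseChange ℂ) '' (𝔞 : Set (Module.End ℚ W))),
        ∀ p, ∀ x ∈ H.piece p (n - p), Θ x = ((2 * p - n : ℤ) : ℂ) • x) → H.hodgeLie ≤ 𝔞) :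
    ∀ 𝔞 : Submodule ℚ (Module.End ℚ V), 𝔞 ≤ (H.comapEquiv e).hodgeLie →
      (∀ X ∈ 𝔞, ∀ Y ∈ 𝔞, X * Y - Y * X ∈ 𝔞) →
      (∃ Θ ∈ Submodule.span ℂ ((fun X : Module.End ℚ V => X.baseChange ℂ) '' (𝔞 : Set (Module.End ℚ V))),
        ∀ p, ∀ x ∈ (H.comapEquiv e).piece p (n - p), Θ x = ((2 * p - n : ℤ) : ℂ) • x) → (H.comapEquiv e).hodgeLie ≤ 𝔞 := by
  intro 𝔞 h𝔞 hbr hΘ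
  -- `e⁻¹ : H → e^* H` and `e : e^* H → H` as morphisms of Hodge structures, `e ∘ e⁻¹ = id`
  let ι : Hom H (H.comapEquiv e) := Hom.symmOfComapBaseChange e fun _ => rfl
  let π : Hom (H.comapEquiv e) H := Hom.ofComapBaseChange e fun _ => rfl
  have hπι : ∀ w, π.toLinearMap (ι.toLinearMap w) = w := e.apply_symm_apply
  -- conjugation by `e` maps `𝔞` onto `𝔥(H)`
  have himg := map_restrict_eq_hodgeLie_of_rigid ι π hπι hrig 𝔞 h𝔞 hbr hΘ
  intro Y hY
  have h1 : e.toLinearMap ∘ₗ Y ∘ₗ e.symm.toLinearMap ∈ H.hodgeLie := conj_mem_hodgeLie_of_mem_hodgeLie_comapEquiv H e hY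
  rw [← himg] at h1
  obtain ⟨X, hX, hXY⟩ := Submodule.mem_map.1 h1
  change e.toLinearMap ∘ₗ X ∘ₗ e.symm.toLinearMap = e.toLinearMap ∘ₗ Y ∘ₗ e.symm.toLinearMap at hXY
  have hXY' : X = Y := by
    refine LinearMap.ext fun v => ?_
    have h := LinearMap.congr_fun hXY (e v)
    simp only [LinearMap.comp_apply, LinearEquiv.coe_coe, LinearEquiv.symm_apply_apply] at h
    exact e.injective h
  exact hXY' ▸ hX

/-- **`H` `Θ`-rigid ⟺ `e^* H` `Θ`-rigid** (both transports, through the mutually inverse morphisms `e^* H ⇄ H`; stated as an `iff` — the bare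
converse has the shape of the tree's other rigidity theorems). [cite: Moonen1999MTNotes, (1.7) and (1.8)] [cite: MoonenZarhin1999LowDim, §3 (3.1)] -/
theorem rigid_iff_rigid_comapEquiv (H : HodgeStructure W n) (e : V ≃ₗ[ℚ] W) :
    (∀ 𝔞 : Submodule ℚ (Module.End ℚ W), 𝔞 ≤ H.hodgeLie →
      (∀ X ∈ 𝔞, ∀ Y ∈ 𝔞, X * Y - Y * X ∈ 𝔞) →
      (∃ Θ ∈ Submodule.span ℂ ((fun X : Module.End ℚ W => X.baseChange ℂ) '' (𝔞 : Set (Module.End ℚ W))),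
        ∀ p, ∀ x ∈ H.piece p (n - p), Θ x = ((2 * p - n : ℤ) : ℂ) • x) → H.hodgeLie ≤ 𝔞) ↔
    ∀ 𝔞 : Submodule ℚ (Module.End ℚ V), 𝔞 ≤ (H.comapEquiv e).hodgeLie →
      (∀ X ∈ 𝔞, ∀ Y ∈ 𝔞, X * Y - Y * X ∈ 𝔞) →
      (∃ Θ ∈ Submodule.span ℂ ((fun X : Module.End ℚ V => X.baseChange ℂ) '' (𝔞 : Set (Module.End ℚ V))),
        ∀ p, ∀ x ∈ (H.comapEquiv e).piece p (n - p), Θ x = ((2 * p - n : ℤ) : ℂ) • x) → (H.comapEquiv e).hodgeLie ≤ 𝔞 := by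
  refine ⟨rigid_comapEquiv_of_rigid H e, fun hrig => ?_⟩
  intro 𝔞 h𝔞 hbr hΘ
  let ι : Hom (H.comapEquiv e) H := Hom.ofComapBaseChange e fun _ => rfl
  let π : Hom H (H.comapEquiv e) := Hom.symmOfComapBaseChange e fun _ => rfl
  have hπι : ∀ v, π.toLinearMap (ι.toLinearMap v) = v := e.symm_apply_apply
  have himg := map_restrict_eq_hodgeLie_of_rigid ι π hπι hrig 𝔞 h𝔞 hbr hΘ
  intro Y hY
  have h1 : e.symm.toLinearMap ∘ₗ Y ∘ₗ e.toLinearMap ∈ (H.comapEquiv e).hodgeLie := conj_symm_mem_hodgeLie_comapEquiv H e hY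
  rw [← himg] at h1
  obtain ⟨X, hX, hXY⟩ := Submodule.mem_map.1 h1
  change e.symm.toLinearMap ∘ₗ X ∘ₗ e.toLinearMap = e.symm.toLinearMap ∘ₗ Y ∘ₗ e.toLinearMap at hXY
  have hXY' : X = Y := by
    refine LinearMap.ext fun w => ?_
    have h := LinearMap.congr_fun hXY (e.symm w)
    simp only [LinearMap.comp_apply, LinearEquiv.coe_coe, LinearEquiv.apply_symm_apply] at h
    exact e.symm.injective h
  exact hXY' ▸ hX

end HodgeStructure

end Literature.AlgebraicGeometry.Motives

end
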